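import Summits.KontsevichZagierPeriods.KontsevichZagierPeriods.Theses.HurwitzMicroSectors
import Summits.KontsevichZagierPeriods.KontsevichZagierPeriods.Theorems.HurwitzMicroSectorsNormalFormPrinciplePiBoxTransfer
import Summits.KontsevichZagierPeriods.KontsevichZagierPeriods.Theorems.HurwitzMicroSectorsNormalFormPrincipleBoxRigidityDimOne

/-! TTRL-lite variant V2203 of stmt-KontsevichZagierPeriods-3869

Variant V2203 = `stub_boxRigidity` (the leaf `BoxRigidity` of `NormalFormPrinciple`: two BOX-RATIONAL
representations — domain the open unit box, integrand `p/q` over `ℚ` — with equal values are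
KZ-equivalent) with BOTH dimensions frozen, `fix m := 2; fix m' := 2`. Verdict of the attempt seat:
**open** — this file is the certificate (what the variant is equivalent to, what it would settle, why it
cannot be refuted), not a proof of the variant.

* Unlike the one-sided moves (`…Variants2200/2219/2231/2241/2246/2251/2256`, all equivalent to the
  parent), a JOINT freeze is a genuine weakening, and the frozen instances form a ladder: for every `k`,
  "BoxRigidity at `m = m' = k`" ⟺ "BoxRigidity for all `m, m' ≤ k`" ⟺ "BoxVanishing at dimension `k`"
  (`boxRigidityLe_iff_boxRigidityAt`, `boxRigidityAt_iff_boxVanishingAt`: pad by unit intervals — one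
  Newton–Leibniz move each, `stub_boxCombineAux.pad_le` — and subtract on the common box, rule 1b),
  `stub_boxCombineAux.sub_same`; the same transfer for the sibling `m = 2, m' ≤ 2` is `…Variants2204`), the rungs increase with `k` (`boxRigidityAt_mono`) and their
  conjunction is the parent leaf (`boxRigidity_iff_forall_boxRigidityAt`).
* Rungs `k ≤ 1` are theorems (`boxRigidity_of_le_one`, Baker; `boxRigidityAt_zero`, `boxRigidityAt_one`).
  V2203 is rung `k = 2` (`stub_boxRigidity_var2203_iff_le_two`,
  `stub_boxRigidity_var2203_iff_boxVanishing_two`): Conjecture 1 for ALL box-rational representations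
  of dimension `≤ 2`, i.e. completeness of the KZ rules for every `ℚ`-linear relation among the
  integrals `∫∫_{(0,1)²} p/q` (`π²`, `G`, `π log 2`, `log² 2`, `L(2,χ₋₃)`, dilogarithm values, …).
* Upward: `KontsevichZagierPeriods → parent → V2203` (`stub_boxRigidity_var2203_of_statement`), so a
  refutation of V2203 refutes the Summit. Downward: V2203 gives Conjecture 1 on EVERY weight-two
  level-`N` box sector `P(xy)/(1 − (xy)ᴺ)` with NO linear-independence input
  (`levelSector_of_stub_boxRigidity_var2203`); the tree has the level-`4` rung only under the open
  `Indep_ℚ(1, π², G)` (`CatalanSectorTwoFour`) and the level-`6` rung under Calegari–Dimitrov–Tang's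
  theorem (`SectorTwoSix`): `catalanSector_unconditional_of_stub_boxRigidity_var2203`,
  `sectorTwoSix_unconditional_of_stub_boxRigidity_var2203`. No mechanism in the tree (reduction to
  normal forms + a linear-independence theorem, rung by rung) reaches all of dimension `2` at once.
Source: M. Kontsevich, D. Zagier, *Periods* (2001), §1.2 Conjecture 1; A. Baker, *Transcendental Number
Theory* (1975), Thm. 2.1 (rungs `≤ 1`). Pure proof file, no definitions. -/

-- `Summit.<Summit>.<Problem>` is the tree's mandated summit-side namespace (CONVENTIONS §2); for this
-- single-conjunct summit the two coincide, so the duplicate is deliberate.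
set_option linter.dupNamespace false

noncomputable section

namespace Summit.KontsevichZagierPeriods.KontsevichZagierPeriods.Theorems

open MeasureTheory Set
open Literature.NumberTheory.Transcendental Literature.NumberTheory.Transcendental.KZ
open Summit.KontsevichZagierPeriods.KontsevichZagierPeriods.Theses.HurwitzMicroSectors
open Summit.KontsevichZagierPeriods.HurwitzMicroSectors.NormalFormPrinciple.PiBox
open Summit.KontsevichZagierPeriods.HurwitzMicroSectors.NormalFormPrinciple.PiBox.stub_boxCombineAux
  (pad_le sub_same)

/-! ## The ladder of joint dimension bounds

The three transfer lemmas (rigidity at `(k,k)` ⇒ vanishing at `k`: compare with the zero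
representation; vanishing at `k` ⇒ vanishing below `k`: pad by unit intervals, `pad_le`; vanishing at
`k` ⇒ rigidity for all `m, m' ≤ k`: pad both and subtract on the common box, `sub_same`) are kept
`private` here — public copies with the same statements are the sibling certificate's
(`…Variants2204`: `boxVanishingAt_of_boxRigidityAt`, `boxVanishingLe_of_boxVanishingAt`,
`boxRigidityLe_of_boxVanishingAt`); this file assembles them into the ladder. -/

/-- BoxRigidity at `(k, k)` ⇒ BoxVanishing at `k` (compare a box-rational representation of value `0`
with the zero representation on the `k`-box). [cite: KontsevichZagier2001, §1.2 Conjecture 1] -/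
private theorem vanishingAt_of_rigidityAt (k : ℕ)
    (hrig : ∀ (N N' : IntegralRep k),
      N.domain = {x | ∀ i, x i ∈ Set.Ioo (0:ℝ) 1} → N.IsRational →
      N'.domain = {x | ∀ i, x i ∈ Set.Ioo (0:ℝ) 1} → N'.IsRational →
      N.value = N'.value → Equivalent N N')
    (N : IntegralRep k) (hNd : N.domain = {x | ∀ i, x i ∈ Set.Ioo (0:ℝ) 1}) (hNr : N.IsRational)
    (hv : N.value = 0) : of N ∈ relations := by
  obtain ⟨Z, hZd, hZi⟩ := exists_zeroRep (isSemialgebraic_box k)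
  have hZ : of Z ∈ relations := of_mem_relations_of_eqOn_zero Z (by simp [hZi, EqOn])
  have hZv : Z.value = 0 := by simp [IntegralRep.value, hZi]
  have hZr : Z.IsRational := ⟨0, 1, fun x _ => by simp, fun x _ => by simp [hZi]⟩
  have h : of N - of Z ∈ relations := hrig N Z hNd hNr hZd hZr (by rw [hv, hZv])
  simpa using relations.add_mem h hZ

/-- BoxVanishing at `k` ⇒ BoxRigidity for all `m, m' ≤ k` (pad both representations to the `k`-box,
`pad_le`; subtract on the common box, `sub_same`; the difference has value `0` by soundness).
[cite: KontsevichZagier2001, §1.2] -/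
private theorem rigidityLe_of_vanishingAt (k : ℕ)
    (hvan : ∀ N : IntegralRep k, N.domain = {x | ∀ i, x i ∈ Set.Ioo (0:ℝ) 1} → N.IsRational →
      N.value = 0 → of N ∈ relations) :
    ∀ (m m' : ℕ), m ≤ k → m' ≤ k → ∀ (N : IntegralRep m) (N' : IntegralRep m'),
      N.domain = {x | ∀ i, x i ∈ Set.Ioo (0:ℝ) 1} → N.IsRational →
      N'.domain = {x | ∀ i, x i ∈ Set.Ioo (0:ℝ) 1} → N'.IsRational →
      N.value = N'.value → Equivalent N N' := by
  intro m m' hm hm' N N' hNd hNr hN'd hN'r hv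
  obtain ⟨R₁, h₁d, h₁r, h₁⟩ := pad_le hm N hNd hNr
  obtain ⟨R₂, h₂d, h₂r, h₂⟩ := pad_le hm' N' hN'd hN'r
  obtain ⟨M, hMd, hMr, hM⟩ := sub_same R₁ R₂ h₁d h₁r h₂d h₂r
  have hMv : M.value = 0 := by
    have e₁ := relations_le_ker_eval_holds h₁
    have e₂ := relations_le_ker_eval_holds h₂
    have e := relations_le_ker_eval_holds hM
    rw [AddMonoidHom.mem_ker, map_sub, eval_of, eval_of, sub_eq_zero] at e₁ e₂
    rw [AddMonoidHom.mem_ker, map_sub, map_sub, eval_of, eval_of, eval_of, ← e₁, ← e₂, hv,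
      sub_self, zero_sub, neg_eq_zero] at e
    exact e
  show of N - of N' ∈ relations
  have : of N - of N' = (of N - of R₁) - (of N' - of R₂) + (of R₁ - of R₂ - of M) + of M := by abel
  rw [this]
  exact relations.add_mem (relations.add_mem (relations.sub_mem h₁ h₂) hM) (hvan M hMd hMr hMv)

/-- **Joint bound ⟺ top rung**: BoxRigidity for all `m, m' ≤ k` is equivalent to its single
instance `m = m' = k`. [cite: KontsevichZagier2001, §1.2 Conjecture 1] -/
theorem boxRigidityLe_iff_boxRigidityAt (k : ℕ) :
    (∀ (m m' : ℕ), m ≤ k → m' ≤ k → ∀ (N : IntegralRep m) (N' : IntegralRep m'),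
      N.domain = {x | ∀ i, x i ∈ Set.Ioo (0:ℝ) 1} → N.IsRational →
      N'.domain = {x | ∀ i, x i ∈ Set.Ioo (0:ℝ) 1} → N'.IsRational →
      N.value = N'.value → Equivalent N N') ↔
    (∀ (N N' : IntegralRep k),
      N.domain = {x | ∀ i, x i ∈ Set.Ioo (0:ℝ) 1} → N.IsRational →
      N'.domain = {x | ∀ i, x i ∈ Set.Ioo (0:ℝ) 1} → N'.IsRational →
      N.value = N'.value → Equivalent N N') :=
  ⟨fun h N N' => h k k le_rfl le_rfl N N',
    fun h => rigidityLe_of_vanishingAt k (vanishingAt_of_rigidityAt k h)⟩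

/-- **Rung `k` ⟺ BoxVanishing at dimension `k`.** [cite: KontsevichZagier2001, §1.2 Conjecture 1] -/
theorem boxRigidityAt_iff_boxVanishingAt (k : ℕ) :
    (∀ (N N' : IntegralRep k),
      N.domain = {x | ∀ i, x i ∈ Set.Ioo (0:ℝ) 1} → N.IsRational →
      N'.domain = {x | ∀ i, x i ∈ Set.Ioo (0:ℝ) 1} → N'.IsRational →
      N.value = N'.value → Equivalent N N') ↔
    (∀ N : IntegralRep k, N.domain = {x | ∀ i, x i ∈ Set.Ioo (0:ℝ) 1} → N.IsRational →
      N.value = 0 → of N ∈ relations) :=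
  ⟨vanishingAt_of_rigidityAt k, fun h N N' => rigidityLe_of_vanishingAt k h k k le_rfl le_rfl N N'⟩

/-- **The rungs increase**: BoxRigidity at dimension `K` implies it at every dimension `k ≤ K`.
[cite: KontsevichZagier2001, §1.2 Conjecture 1] -/
theorem boxRigidityAt_mono {k K : ℕ} (hkK : k ≤ K)
    (h : ∀ (N N' : IntegralRep K),
      N.domain = {x | ∀ i, x i ∈ Set.Ioo (0:ℝ) 1} → N.IsRational →
      N'.domain = {x | ∀ i, x i ∈ Set.Ioo (0:ℝ) 1} → N'.IsRational →
      N.value = N'.value → Equivalent N N') :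
    ∀ (N N' : IntegralRep k),
      N.domain = {x | ∀ i, x i ∈ Set.Ioo (0:ℝ) 1} → N.IsRational →
      N'.domain = {x | ∀ i, x i ∈ Set.Ioo (0:ℝ) 1} → N'.IsRational →
      N.value = N'.value → Equivalent N N' :=
  fun N N' => rigidityLe_of_vanishingAt K (vanishingAt_of_rigidityAt K h) k k hkK hkK N N'

/-- **The parent leaf is the conjunction of its diagonal rungs**: `BoxRigidity ⟺ ∀ k, BoxRigidity at
m = m' = k` (given `m, m'`, use the rung `max m m'`). So the programmatic move `fix m := k; fix m' := k`
produces exactly the `k`-th member of an increasing chain exhausting the leaf.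
[cite: KontsevichZagier2001, §1.2 Conjecture 1] -/
theorem boxRigidity_iff_forall_boxRigidityAt :
    (∀ (m m' : ℕ) (N : IntegralRep m) (N' : IntegralRep m'),
      N.domain = {x | ∀ i, x i ∈ Set.Ioo (0:ℝ) 1} → N.IsRational →
      N'.domain = {x | ∀ i, x i ∈ Set.Ioo (0:ℝ) 1} → N'.IsRational →
      N.value = N'.value → Equivalent N N') ↔
    ∀ (k : ℕ) (N N' : IntegralRep k),
      N.domain = {x | ∀ i, x i ∈ Set.Ioo (0:ℝ) 1} → N.IsRational →
      N'.domain = {x | ∀ i, x i ∈ Set.Ioo (0:ℝ) 1} → N'.IsRational →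
      N.value = N'.value → Equivalent N N' :=
  ⟨fun h k N N' => h k k N N',
    fun h m m' N N' => (boxRigidityLe_iff_boxRigidityAt (max m m')).2 (h (max m m')) m m'
      (le_max_left m m') (le_max_right m m') N N'⟩

/-- **Rung `0` is a theorem** (instance `m = m' = 0` of `boxRigidity_of_le_one`: rational constants).
[cite: Baker1975, Thm. 2.1] -/
theorem boxRigidityAt_zero :
    ∀ (N N' : IntegralRep 0),
      N.domain = {x | ∀ i, x i ∈ Set.Ioo (0:ℝ) 1} → N.IsRational →
      N'.domain = {x | ∀ i, x i ∈ Set.Ioo (0:ℝ) 1} → N'.IsRational →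
      N.value = N'.value → Equivalent N N' :=
  Dlog.boxRigidity_of_le_one 0 0 (Nat.zero_le 1) (Nat.zero_le 1)

/-- **Rung `1` is a theorem** (instance `m = m' = 1` of `boxRigidity_of_le_one`, Baker's theorem on
linear forms in logarithms: values in `ℚ̄ + Σ ℚ̄ log ℚ̄ + ℚ̄π`). [cite: Baker1975, Thm. 2.1] -/
theorem boxRigidityAt_one :
    ∀ (N N' : IntegralRep 1),
      N.domain = {x | ∀ i, x i ∈ Set.Ioo (0:ℝ) 1} → N.IsRational →
      N'.domain = {x | ∀ i, x i ∈ Set.Ioo (0:ℝ) 1} → N'.IsRational →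
      N.value = N'.value → Equivalent N N' :=
  Dlog.boxRigidity_of_le_one 1 1 le_rfl le_rfl

/-! ## The variant V2203 itself: rung `2` -/

/-- **V2203 ⟺ BoxRigidity for ALL `m, m' ≤ 2`** (Conjecture 1 for every pair of box-rational
representations of dimensions at most two, mixed dimensions included).
[cite: KontsevichZagier2001, §1.2 Conjecture 1] -/
theorem stub_boxRigidity_var2203_iff_le_two :
    (∀ (N : IntegralRep 2) (N' : IntegralRep 2), N.domain = {x | ∀ i, x i ∈ Set.Ioo (0:ℝ) 1} → N.IsRational → N'.domain = {x | ∀ i, x i ∈ Set.Ioo (0:ℝ) 1} → N'.IsRational → N.value = N'.value → Equivalent N N') ↔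
    (∀ (m m' : ℕ), m ≤ 2 → m' ≤ 2 → ∀ (N : IntegralRep m) (N' : IntegralRep m'),
      N.domain = {x | ∀ i, x i ∈ Set.Ioo (0:ℝ) 1} → N.IsRational →
      N'.domain = {x | ∀ i, x i ∈ Set.Ioo (0:ℝ) 1} → N'.IsRational →
      N.value = N'.value → Equivalent N N') :=
  (boxRigidityLe_iff_boxRigidityAt 2).symm

/-- **V2203 ⟺ BoxVanishing at dimension two**: every box-rational `∫∫_{(0,1)²} p/q = 0` is a formal
consequence of the KZ rules. [cite: KontsevichZagier2001, §1.2 Conjecture 1] -/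
theorem stub_boxRigidity_var2203_iff_boxVanishing_two :
    (∀ (N : IntegralRep 2) (N' : IntegralRep 2), N.domain = {x | ∀ i, x i ∈ Set.Ioo (0:ℝ) 1} → N.IsRational → N'.domain = {x | ∀ i, x i ∈ Set.Ioo (0:ℝ) 1} → N'.IsRational → N.value = N'.value → Equivalent N N') ↔
    (∀ N : IntegralRep 2, N.domain = {x | ∀ i, x i ∈ Set.Ioo (0:ℝ) 1} → N.IsRational →
      N.value = 0 → of N ∈ relations) :=
  boxRigidityAt_iff_boxVanishingAt 2

/-- **Parent ⇒ V2203** (the variant is the instance `m = m' = 2` of the leaf).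
[cite: KontsevichZagier2001, §1.2 Conjecture 1] -/
theorem stub_boxRigidity_var2203_of_parent
    (h : ∀ (m m' : ℕ) (N : IntegralRep m) (N' : IntegralRep m'), N.domain = {x | ∀ i, x i ∈ Set.Ioo (0:ℝ) 1} → N.IsRational → N'.domain = {x | ∀ i, x i ∈ Set.Ioo (0:ℝ) 1} → N'.IsRational → N.value = N'.value → Equivalent N N') :
    ∀ (N : IntegralRep 2) (N' : IntegralRep 2), N.domain = {x | ∀ i, x i ∈ Set.Ioo (0:ℝ) 1} → N.IsRational → N'.domain = {x | ∀ i, x i ∈ Set.Ioo (0:ℝ) 1} → N'.IsRational → N.value = N'.value → Equivalent N N' :=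
  h 2 2

/-- **`KontsevichZagierPeriods ⇒ V2203`**: the variant is a special case of Conjecture 1 for the
tree's calculus — a refutation of V2203 would refute the Summit. [cite: KontsevichZagier2001, §1.2 Conjecture 1] -/
theorem stub_boxRigidity_var2203_of_statement (h : _root_.KontsevichZagierPeriods) :
    ∀ (N : IntegralRep 2) (N' : IntegralRep 2), N.domain = {x | ∀ i, x i ∈ Set.Ioo (0:ℝ) 1} → N.IsRational → N'.domain = {x | ∀ i, x i ∈ Set.Ioo (0:ℝ) 1} → N'.IsRational → N.value = N'.value → Equivalent N N' :=
  (leaves_of_statement h).1 2 2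

/-- **V2203 contains the proved rungs**: it implies BoxRigidity at dimensions `≤ 1` (which are
theorems, `boxRigidityAt_one`, `boxRigidityAt_zero` — consistency, not evidence).
[cite: KontsevichZagier2001, §1.2 Conjecture 1] -/
theorem boxRigidityAt_one_of_stub_boxRigidity_var2203
    (h : ∀ (N : IntegralRep 2) (N' : IntegralRep 2), N.domain = {x | ∀ i, x i ∈ Set.Ioo (0:ℝ) 1} → N.IsRational → N'.domain = {x | ∀ i, x i ∈ Set.Ioo (0:ℝ) 1} → N'.IsRational → N.value = N'.value → Equivalent N N') :
    ∀ (N N' : IntegralRep 1),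
      N.domain = {x | ∀ i, x i ∈ Set.Ioo (0:ℝ) 1} → N.IsRational →
      N'.domain = {x | ∀ i, x i ∈ Set.Ioo (0:ℝ) 1} → N'.IsRational →
      N.value = N'.value → Equivalent N N' :=
  boxRigidityAt_mono one_le_two h

/-! ## What V2203 would settle: every weight-two box sector, unconditionally -/

/-- Sector members are box-rational: a representation on the open box whose integrand agrees there
with `P(xy)/(1 − (xy)ᴺ)` (`N ≥ 1`, `P ∈ ℚ[t]`) has KZ's rational shape (`p = P(X₀X₁)`,
`q = 1 − (X₀X₁)ᴺ ≠ 0` on the box); public copy: `isRational_of_sectorTwo` (`…Variants2204`).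
[cite: KontsevichZagier2001, §1.1 Definition] -/
private theorem isRational_of_levelSector {Nl : ℕ} (hN : 1 ≤ Nl) (r : IntegralRep 2)
    (P : Polynomial ℚ) (hrd : r.domain = {x | ∀ i, x i ∈ Set.Ioo (0:ℝ) 1})
    (hri : EqOn r.integrand (fun x => Polynomial.aeval (x 0 * x 1) P / (1 - (x 0 * x 1) ^ Nl)) r.domain) :
    r.IsRational := by
  refine ⟨Polynomial.aeval (MvPolynomial.X 0 * MvPolynomial.X 1 : MvPolynomial (Fin 2) ℚ) P,
    1 - (MvPolynomial.X 0 * MvPolynomial.X 1) ^ Nl, fun x hx => ?_, fun x hx => ?_⟩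
  · rw [hrd] at hx
    have h0 : 0 < x 0 * x 1 := mul_pos (hx 0).1 (hx 1).1
    have h1 : x 0 * x 1 < 1 := mul_lt_one_of_nonneg_of_lt_one_left (hx 0).1.le (hx 0).2 (hx 1).2.le
    have hlt : (x 0 * x 1) ^ Nl < 1 := pow_lt_one₀ h0.le h1 (by omega)
    simp only [map_sub, map_one, map_pow, map_mul, MvPolynomial.aeval_X]
    exact sub_ne_zero.2 (ne_of_gt hlt)
  · show r.integrand x = _
    rw [hri hx]
    simp only [map_sub, map_one, map_pow, map_mul, MvPolynomial.aeval_X]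
    rw [← Polynomial.aeval_algHom_apply]
    simp

/-- **V2203 ⇒ Conjecture 1 on every weight-two level-`N` box sector, with no independence input**:
two representations on the open box with integrands `P(xy)/(1 − (xy)ᴺ)`, `P'(xy)/(1 − (xy)ᴺ)` and
equal values are KZ-equivalent (`N ≥ 1` arbitrary). The route closes such rungs one at a time and
only given a linear-independence theorem for the rung's values. [cite: KontsevichZagier2001, §1.2 Conjecture 1] -/
theorem levelSector_of_stub_boxRigidity_var2203
    (h : ∀ (N : IntegralRep 2) (N' : IntegralRep 2), N.domain = {x | ∀ i, x i ∈ Set.Ioo (0:ℝ) 1} → N.IsRational → N'.domain = {x | ∀ i, x i ∈ Set.Ioo (0:ℝ) 1} → N'.IsRational → N.value = N'.value → Equivalent N N')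
    {Nl : ℕ} (hN : 1 ≤ Nl) :
    ∀ (r r' : IntegralRep 2) (P P' : Polynomial ℚ),
      r.domain = {x | ∀ i, x i ∈ Set.Ioo (0:ℝ) 1} → r'.domain = {x | ∀ i, x i ∈ Set.Ioo (0:ℝ) 1} →
      EqOn r.integrand (fun x => Polynomial.aeval (x 0 * x 1) P / (1 - (x 0 * x 1) ^ Nl)) r.domain →
      EqOn r'.integrand (fun x => Polynomial.aeval (x 0 * x 1) P' / (1 - (x 0 * x 1) ^ Nl)) r'.domain →
      r.value = r'.value → Equivalent r r' :=
  fun r r' P P' hrd hr'd hri hr'i hv =>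
    h r r' hrd (isRational_of_levelSector hN r P hrd hri) hr'd
      (isRational_of_levelSector hN r' P' hr'd hr'i) hv

/-- **V2203 ⇒ the Catalan rung `(2,4)` UNCONDITIONALLY** — the conclusion of `CatalanSectorTwoFour`
without its hypothesis `Indep_ℚ(1, π², G)` (open: it contains the irrationality of Catalan's
constant), which is the only form in which the tree has this rung. [cite: KontsevichZagier2001, §1.2 Conjecture 1] -/
theorem catalanSector_unconditional_of_stub_boxRigidity_var2203
    (h : ∀ (N : IntegralRep 2) (N' : IntegralRep 2), N.domain = {x | ∀ i, x i ∈ Set.Ioo (0:ℝ) 1} → N.IsRational → N'.domain = {x | ∀ i, x i ∈ Set.Ioo (0:ℝ) 1} → N'.IsRational → N.value = N'.value → Equivalent N N') :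
    ∀ (r r' : IntegralRep 2) (P P' : Polynomial ℚ),
      r.domain = {x | ∀ i, x i ∈ Set.Ioo (0:ℝ) 1} → r'.domain = {x | ∀ i, x i ∈ Set.Ioo (0:ℝ) 1} →
      EqOn r.integrand (fun x => Polynomial.aeval (x 0 * x 1) P / (1 - (x 0 * x 1) ^ 4)) r.domain →
      EqOn r'.integrand (fun x => Polynomial.aeval (x 0 * x 1) P' / (1 - (x 0 * x 1) ^ 4)) r'.domain →
      r.value = r'.value → Equivalent r r' :=
  levelSector_of_stub_boxRigidity_var2203 h (by norm_num)

/-- **V2203 ⇒ the CDT rung `(2,6)` UNCONDITIONALLY** — the conclusion of `SectorTwoSix` without its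
hypothesis (Calegari–Dimitrov–Tang's independence of `1, π², L(2,χ₋₃)`).
[cite: KontsevichZagier2001, §1.2 Conjecture 1] -/
theorem sectorTwoSix_unconditional_of_stub_boxRigidity_var2203
    (h : ∀ (N : IntegralRep 2) (N' : IntegralRep 2), N.domain = {x | ∀ i, x i ∈ Set.Ioo (0:ℝ) 1} → N.IsRational → N'.domain = {x | ∀ i, x i ∈ Set.Ioo (0:ℝ) 1} → N'.IsRational → N.value = N'.value → Equivalent N N') :
    ∀ (r r' : IntegralRep 2) (P P' : Polynomial ℚ),
      r.domain = {x | ∀ i, x i ∈ Set.Ioo (0:ℝ) 1} → r'.domain = {x | ∀ i, x i ∈ Set.Ioo (0:ℝ) 1} →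
      EqOn r.integrand (fun x => Polynomial.aeval (x 0 * x 1) P / (1 - (x 0 * x 1) ^ 6)) r.domain →
      EqOn r'.integrand (fun x => Polynomial.aeval (x 0 * x 1) P' / (1 - (x 0 * x 1) ^ 6)) r'.domain →
      r.value = r'.value → Equivalent r r' :=
  levelSector_of_stub_boxRigidity_var2203 h (by norm_num)

/-- **V2203 ⇒ `CatalanSectorTwoFour`** and **⇒ `SectorTwoSix`** BY NAME (both already theorems of
the tree in their conditional form; recorded to place the variant above both rungs in the item graph).
[cite: KontsevichZagier2001, §1.2 Conjecture 1] -/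
theorem catalanSectorTwoFour_and_sectorTwoSix_of_stub_boxRigidity_var2203
    (h : ∀ (N : IntegralRep 2) (N' : IntegralRep 2), N.domain = {x | ∀ i, x i ∈ Set.Ioo (0:ℝ) 1} → N.IsRational → N'.domain = {x | ∀ i, x i ∈ Set.Ioo (0:ℝ) 1} → N'.IsRational → N.value = N'.value → Equivalent N N') :
    CatalanSectorTwoFour ∧ SectorTwoSix :=
  ⟨fun _ => catalanSector_unconditional_of_stub_boxRigidity_var2203 h,
    fun _ => sectorTwoSix_unconditional_of_stub_boxRigidity_var2203 h⟩

end Summit.KontsevichZagierPeriods.KontsevichZagierPeriods.Theorems
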